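import Summits.Ventures.PercRepro.DecisionTreeHK

/-!
# The van den Berg–Kesten inequality for decision trees (Gladkov, Theorem 4.3)

A *witness* of an event `A` in a configuration `ω` is an edge set `I` whose states in `ω`
force `A` (`Witness`, Gladkov arXiv:2408.08457 Definition 4.1).  For a decision tree
(`DecisionTree.lean`) building the edge set `S = run t ω ω'` from two independent
configurations, Gladkov's disjoint occurrence `A □_S B` (Definition 4.2, `DisjOcc`) asks for a
witness `I` of `A` in `ω` and a witness `J` of `B` in the mixed configuration `ω →_S ω'` that
overlap only off `S` — on `S` both configurations read the same bits of `ω`, off `S` the mixed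
configuration reads the independent copy `ω'`.

**Theorem 4.3** (`DTree.vdbk`): for a proper tree and increasing `A`, `B`,
`P((ω, ω') ∈ A □_S B) ≤ P(A) · P(B)`.  For `S = ∅` the event is `A × B` and this is an equality;
for the tree that queries every edge into `S` it is the classical van den Berg–Kesten inequality
`P(A □ B) ≤ P(A) P(B)` (`BKInequality.lean`).

Proof by structural induction on the tree (`DTree.vdbk_aux`), in the style of
`DecisionTreeHK.lean`: with `S₀ ⊆ Q` the queried edges already sent to `S` and two weight vectors
agreeing off `Q`, `E[1_{A □_{S₀ ∪ S} B}] ≤ E[1_{A □_{S₀} B}]`.  A leaf contributes nothing.  At a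
node querying `e` the two-copy expectation splits along `e` in both copies
(`expectPair_split`); the subtrees give the bound with `S₀ ∪ [toS]{e}`, and for an edge sent to
`S` one more step is needed (`expectPair_disjInd_insert_le`): adding `e` to the mixing set can
only lose measure.  Its proof is Gladkov's exchange argument in the form of an involution: a pair
in `A □_{S₀ ∪ {e}} B` but not in `A □_{S₀} B` has `e` open in `ω` and closed in `ω'`, and exchanging
the states of `e` between the two copies (`swapBit`, weight-preserving because both copies carry
the same Bernoulli factor at an unqueried edge) produces a pair in `A □_{S₀} B` but not in
`A □_{S₀ ∪ {e}} B` (`disjOcc_swap_of_bad`).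
-/

namespace PercRepro

open Finset

variable {E : Type*}

/-! ### Witnesses and disjoint occurrence along a mixing set -/

/-- `Witness A I ω`: the states of `ω` on the edge set `I` force the event `A`
(Gladkov, Definition 4.1). -/
def Witness (A : Set (Config E)) (I : Set E) (ω : Config E) : Prop :=
  ∀ ω' : Config E, (∀ e ∈ I, ω' e = ω e) → ω' ∈ A

/-- Gladkov's `A □_S B` (Definition 4.2): `A` occurs in `ω` with a witness `I`, `B` occurs in
`ω →_S ω'` with a witness `J`, and the witnesses overlap only off `S`. -/
def DisjOcc (A B : Set (Config E)) (S : Set E) (ω ω' : Config E) : Prop :=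
  ∃ I J : Set E, Witness A I ω ∧ Witness B J (mix S ω ω') ∧ I ∩ J ⊆ Sᶜ

open Classical in
/-- The indicator of `A □_S B` at the pair `(ω, ω')`. -/
noncomputable def disjInd (A B : Set (Config E)) (S : Set E) (ω ω' : Config E) : ℝ :=
  if DisjOcc A B S ω ω' then 1 else 0

/-- A witness stays a witness when enlarged. -/
theorem witness_mono {A : Set (Config E)} {I J : Set E} (hIJ : I ⊆ J) {ω : Config E}
    (h : Witness A I ω) : Witness A J ω :=
  fun ω' hω' => h ω' fun e he => hω' e (hIJ he)

/-- A witness only looks at the states on its edge set. -/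
theorem witness_congr {A : Set (Config E)} {I : Set E} {ω ω₂ : Config E}
    (h : Witness A I ω) (hω : ∀ e ∈ I, ω₂ e = ω e) : Witness A I ω₂ :=
  fun ω' hω' => h ω' fun e he => (hω' e he).trans (hω e he)

/-- A configuration with a witness of `A` lies in `A`. -/
theorem mem_of_witness {A : Set (Config E)} {I : Set E} {ω : Config E} (h : Witness A I ω) :
    ω ∈ A :=
  h ω fun _ _ => rfl

/-- The whole edge set witnesses `A` exactly on `A`. -/
theorem witness_univ_iff {A : Set (Config E)} {ω : Config E} :
    Witness A Set.univ ω ↔ ω ∈ A := by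
  refine ⟨mem_of_witness, fun h ω' hω' => ?_⟩
  have : ω' = ω := funext fun e => hω' e (Set.mem_univ e)
  rw [this]; exact h

/-- `A □_∅ B` is `A × B`. -/
theorem disjOcc_empty_iff {A B : Set (Config E)} {ω ω' : Config E} :
    DisjOcc A B ∅ ω ω' ↔ ω ∈ A ∧ ω' ∈ B := by
  constructor
  · rintro ⟨I, J, hI, hJ, -⟩
    rw [mix_empty] at hJ
    exact ⟨mem_of_witness hI, mem_of_witness hJ⟩
  · rintro ⟨ha, hb⟩
    refine ⟨Set.univ, Set.univ, witness_univ_iff.mpr ha, ?_, ?_⟩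
    · rw [mix_empty]; exact witness_univ_iff.mpr hb
    · rw [Set.compl_empty]; exact Set.subset_univ _

section Update

variable [DecidableEq E]

/-- For an increasing event, a closed edge can be dropped from a witness. -/
theorem witness_diff_singleton_of_upper {A : Set (Config E)} (hA : IsUpperSet A) {I : Set E}
    {ω : Config E} (h : Witness A I ω) {e : E} (he : ω e = false) :
    Witness A (I \ {e}) ω := by
  intro ω' hω'
  have hmem : Function.update ω' e false ∈ A := by
    refine h _ fun e' he' => ?_
    by_cases hee : e' = e
    · rw [hee, Function.update_self, he]
    · rw [Function.update_of_ne hee]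
      exact hω' e' ⟨he', fun h' => hee (Set.mem_singleton_iff.mp h')⟩
  refine hA ?_ hmem
  intro e'
  by_cases hee : e' = e
  · rw [hee]; simp
  · simp [Function.update_of_ne hee]

/-- Mixing along `insert e S₀` agrees with mixing along `S₀` off `e`. -/
theorem mix_insert_apply_of_ne (S₀ : Set E) (ω ω' : Config E) {e e' : E} (h : e' ≠ e) :
    mix (insert e S₀) ω ω' e' = mix S₀ ω ω' e' := by
  rw [mix_insert, Function.update_of_ne h]

/-- **Gladkov's exchange step.**  If `(ω, ω')` lies in `A □_{S₀ ∪ {e}} B` but not in `A □_{S₀} B`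
(`e ∉ S₀`, `A`, `B` increasing), then `e` is open in `ω` and closed in `ω'`, and the pair with the
states of `e` exchanged lies in `A □_{S₀} B` but not in `A □_{S₀ ∪ {e}} B`. -/
theorem disjOcc_swap_of_bad {A B : Set (Config E)} (hA : IsUpperSet A) (hB : IsUpperSet B)
    {S₀ : Set E} {e : E} (he : e ∉ S₀) {ω ω' : Config E}
    (h1 : DisjOcc A B (insert e S₀) ω ω') (h2 : ¬ DisjOcc A B S₀ ω ω') :
    ω e = true ∧ ω' e = false ∧
      DisjOcc A B S₀ (Function.update ω e false) (Function.update ω' e true) ∧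
      ¬ DisjOcc A B (insert e S₀) (Function.update ω e false) (Function.update ω' e true) := by
  obtain ⟨I, J, hI, hJ, hIJ⟩ := h1
  have hcompl : (insert e S₀)ᶜ ⊆ S₀ᶜ := Set.compl_subset_compl.mpr (Set.subset_insert e S₀)
  -- a witness of `B` along `insert e S₀` that does not look at `e` is one along `S₀`
  have hoff : ∀ J' : Set E, e ∉ J' → Witness B J' (mix (insert e S₀) ω ω') → I ∩ J' ⊆ (insert e S₀)ᶜ →
      DisjOcc A B S₀ ω ω' := by
    intro J' heJ' hJ' hIJ'
    refine ⟨I, J', hI, witness_congr hJ' fun e' he' => ?_, hIJ'.trans hcompl⟩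
    have hne : e' ≠ e := fun h => heJ' (h ▸ he')
    exact (mix_insert_apply_of_ne S₀ ω ω' hne).symm
  -- `e ∈ J`
  have heJ : e ∈ J := by
    by_contra heJ
    exact h2 (hoff J heJ hJ hIJ)
  -- `e ∉ I`
  have heI : e ∉ I := fun heI => by
    have : e ∈ (insert e S₀)ᶜ := hIJ ⟨heI, heJ⟩
    exact (Set.mem_compl_iff _ _).mp this (Set.mem_insert e S₀)
  -- `e` is open in `ω`
  have hωe : ω e = true := by
    by_contra hne
    have hωf : ω e = false := by
      cases h : ω e with
      | false => rfl
      | true => exact absurd h hne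
    have hfalse : mix (insert e S₀) ω ω' e = false := by
      rw [mix_apply_of_mem (Set.mem_insert e S₀), hωf]
    have hJ' := witness_diff_singleton_of_upper hB hJ hfalse
    refine h2 (hoff (J \ {e}) (fun h => h.2 (Set.mem_singleton e)) hJ' ?_)
    exact (Set.inter_subset_inter_right I Set.sdiff_subset).trans hIJ
  -- `e` is closed in `ω'`
  have hω'e : ω' e = false := by
    by_contra hne
    have hω't : ω' e = true := by
      cases h : ω' e with
      | false => exact absurd h hne
      | true => rfl
    have heq : mix S₀ ω ω' = mix (insert e S₀) ω ω' := by
      funext e'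
      by_cases hee : e' = e
      · rw [hee, mix_apply_of_notMem he, mix_apply_of_mem (Set.mem_insert e S₀), hω't, hωe]
      · rw [mix_insert_apply_of_ne S₀ ω ω' hee]
    exact h2 ⟨I, J, hI, by rw [heq]; exact hJ, hIJ.trans hcompl⟩
  -- the exchanged pair mixes along `S₀` to the old mixed configuration
  have hmix : mix S₀ (Function.update ω e false) (Function.update ω' e true) =
      mix (insert e S₀) ω ω' := by
    funext e'
    by_cases hee : e' = e
    · rw [hee, mix_apply_of_notMem he, Function.update_self,
        mix_apply_of_mem (Set.mem_insert e S₀), hωe]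
    · rw [mix_insert_apply_of_ne S₀ ω ω' hee]
      by_cases hS : e' ∈ S₀
      · rw [mix_apply_of_mem hS, mix_apply_of_mem hS, Function.update_of_ne hee]
      · rw [mix_apply_of_notMem hS, mix_apply_of_notMem hS, Function.update_of_ne hee]
  -- ... and along `insert e S₀` to the old configuration mixed along `S₀`
  have hmix' : mix (insert e S₀) (Function.update ω e false) (Function.update ω' e true) =
      mix S₀ ω ω' := by
    rw [mix_insert, hmix, Function.update_self]
    funext e'
    by_cases hee : e' = e
    · rw [hee, Function.update_self, mix_apply_of_notMem he, hω'e]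
    · rw [Function.update_of_ne hee, mix_insert_apply_of_ne S₀ ω ω' hee]
  refine ⟨hωe, hω'e, ?_, ?_⟩
  · refine ⟨I, J, witness_congr hI fun e' he' => ?_, by rw [hmix]; exact hJ, hIJ.trans hcompl⟩
    have hne : e' ≠ e := fun h => heI (h ▸ he')
    exact Function.update_of_ne hne _ _
  · rintro ⟨I', J', hI', hJ', hIJ'⟩
    rw [hmix'] at hJ'
    have hI'' := witness_diff_singleton_of_upper hA hI' (by rw [Function.update_self])
    refine h2 ⟨I' \ {e}, J', witness_congr hI'' fun e' he' => ?_, hJ', ?_⟩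
    · have hne : e' ≠ e := fun h => he'.2 (by rw [h]; exact Set.mem_singleton e)
      exact (Function.update_of_ne hne _ _).symm
    · exact (Set.inter_subset_inter_left J' Set.sdiff_subset).trans (hIJ'.trans hcompl)

/-- Exchanging the states of the edge `e` between the two copies. -/
def swapBit (e : E) (x : Config E × Config E) : Config E × Config E :=
  (Function.update x.1 e (x.2 e), Function.update x.2 e (x.1 e))

/-- The exchange is an involution of the pair space. -/
theorem swapBit_involutive (e : E) : Function.Involutive (swapBit e) := by
  intro x
  simp [swapBit, Function.update_idem, Function.update_eq_self]

end Update

section Sums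

variable [DecidableEq E] [Fintype E]

/-- The weight of the other edges ignores the state of `e`. -/
theorem weightErase_update_bit (p : E → ℝ) (e : E) (ω : Config E) (x : Bool) :
    weightErase p e (Function.update ω e x) = weightErase p e ω := by
  unfold weightErase
  refine Finset.prod_congr rfl fun e' he' => ?_
  rw [Function.update_of_ne (Finset.mem_erase.1 he').1]

/-- Exchanging the states of an edge carrying the same Bernoulli factor in both copies preserves
the product weight. -/
theorem weight_swapBit {p₁ p₂ : E → ℝ} {e : E} (hce : p₁ e = p₂ e) (x : Config E × Config E) :
    weight p₁ (swapBit e x).1 * weight p₂ (swapBit e x).2 = weight p₁ x.1 * weight p₂ x.2 := by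
  simp only [swapBit]
  rw [weight_eq_mul_weightErase p₁ e (Function.update x.1 e (x.2 e)),
    weight_eq_mul_weightErase p₂ e (Function.update x.2 e (x.1 e)),
    weight_eq_mul_weightErase p₁ e x.1, weight_eq_mul_weightErase p₂ e x.2,
    weightErase_update_bit, weightErase_update_bit, Function.update_self,
    Function.update_self, hce]
  by_cases h1 : x.1 e = true <;> by_cases h2 : x.2 e = true <;> simp [h1, h2] <;> ring

/-- A two-copy expectation as a sum over pairs. -/
theorem expectPair_eq_sum_prod (p₁ p₂ : E → ℝ) (F : Config E → Config E → ℝ) :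
    expectPair p₁ p₂ F = ∑ x : Config E × Config E, weight p₁ x.1 * weight p₂ x.2 * F x.1 x.2 := by
  unfold expectPair
  exact (Fintype.sum_prod_type' fun ω ω' => weight p₁ ω * weight p₂ ω' * F ω ω').symm

/-- Two-copy expectations are additive. -/
theorem expectPair_add (p₁ p₂ : E → ℝ) (F G : Config E → Config E → ℝ) :
    expectPair p₁ p₂ (fun ω ω' => F ω ω' + G ω ω') = expectPair p₁ p₂ F + expectPair p₁ p₂ G := by
  unfold expectPair
  simp only [mul_add, Finset.sum_add_distrib]

/-- **Adding an unqueried edge to the mixing set loses measure**: for two copies with the same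
Bernoulli factor at `e ∉ S₀` and increasing `A`, `B`,
`E[1_{A □_{S₀ ∪ {e}} B}] ≤ E[1_{A □_{S₀} B}]` (Gladkov's inequality (6), summed over all
restrictions via the exchange involution `swapBit e`). -/
theorem expectPair_disjInd_insert_le {p₁ p₂ : E → ℝ} (hp₁ : IsProb p₁) (hp₂ : IsProb p₂)
    {A B : Set (Config E)} (hA : IsUpperSet A) (hB : IsUpperSet B) {S₀ : Set E} {e : E}
    (he : e ∉ S₀) (hce : p₁ e = p₂ e) :
    expectPair p₁ p₂ (fun ω ω' => disjInd A B (insert e S₀) ω ω') ≤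
      expectPair p₁ p₂ (fun ω ω' => disjInd A B S₀ ω ω') := by
  classical
  set bad : Config E → Config E → ℝ := fun ω ω' =>
    if DisjOcc A B (insert e S₀) ω ω' ∧ ¬ DisjOcc A B S₀ ω ω' then 1 else 0 with hbad
  set good : Config E → Config E → ℝ := fun ω ω' =>
    if DisjOcc A B S₀ ω ω' ∧ ¬ DisjOcc A B (insert e S₀) ω ω' then 1 else 0 with hgood
  set both : Config E → Config E → ℝ := fun ω ω' =>
    if DisjOcc A B (insert e S₀) ω ω' ∧ DisjOcc A B S₀ ω ω' then 1 else 0 with hboth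
  have h1 : ∀ ω ω', disjInd A B (insert e S₀) ω ω' = both ω ω' + bad ω ω' := by
    intro ω ω'
    simp only [disjInd, hboth, hbad]
    by_cases hS : DisjOcc A B (insert e S₀) ω ω' <;> by_cases hS' : DisjOcc A B S₀ ω ω' <;>
      simp [hS, hS']
  have h2 : ∀ ω ω', disjInd A B S₀ ω ω' = both ω ω' + good ω ω' := by
    intro ω ω'
    simp only [disjInd, hboth, hgood]
    by_cases hS : DisjOcc A B (insert e S₀) ω ω' <;> by_cases hS' : DisjOcc A B S₀ ω ω' <;>
      simp [hS, hS']
  -- the exchange maps the bad pairs into the good pairs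
  have hkey : expectPair p₁ p₂ bad ≤ expectPair p₁ p₂ good := by
    rw [expectPair_eq_sum_prod, expectPair_eq_sum_prod]
    have hre : ∑ x : Config E × Config E, weight p₁ x.1 * weight p₂ x.2 * bad x.1 x.2 =
        ∑ x : Config E × Config E, weight p₁ (swapBit e x).1 * weight p₂ (swapBit e x).2 *
          bad (swapBit e x).1 (swapBit e x).2 :=
      ((swapBit_involutive e).bijective.sum_comp _).symm
    rw [hre]
    refine Finset.sum_le_sum fun x _ => ?_
    rw [weight_swapBit hce]
    refine mul_le_mul_of_nonneg_left ?_ (mul_nonneg (weight_nonneg hp₁ _) (weight_nonneg hp₂ _))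
    simp only [hbad, hgood, swapBit]
    split_ifs with hb hg
    · exact le_rfl
    · exfalso
      apply hg
      obtain ⟨hσ1, hσ2⟩ := hb
      obtain ⟨hu, hv, hD, hnD⟩ := disjOcc_swap_of_bad hA hB he hσ1 hσ2
      rw [Function.update_self] at hu hv
      rw [Function.update_idem, Function.update_idem, ← hv, ← hu, Function.update_eq_self,
        Function.update_eq_self] at hD hnD
      exact ⟨hD, hnD⟩
    · exact zero_le_one
    · exact le_rfl
  have hb1 : expectPair p₁ p₂ (fun ω ω' => disjInd A B (insert e S₀) ω ω') =
      expectPair p₁ p₂ both + expectPair p₁ p₂ bad := by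
    rw [← expectPair_add]; simp only [h1]
  have hb2 : expectPair p₁ p₂ (fun ω ω' => disjInd A B S₀ ω ω') =
      expectPair p₁ p₂ both + expectPair p₁ p₂ good := by
    rw [← expectPair_add]; simp only [h2]
  rw [hb1, hb2]
  exact add_le_add le_rfl hkey

omit [DecidableEq E] [Fintype E] in
/-- The Bernoulli factors are nonnegative. -/
theorem cf_nonneg {p : E → ℝ} (hp : IsProb p) (e : E) (b : Bool) : 0 ≤ cf p e b := by
  unfold cf
  split_ifs
  · exact hp.nonneg e
  · exact hp.one_sub_nonneg e

/-- The inductive statement behind Theorem 4.3: for a tree proper with respect to the queried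
set `Q`, two weight vectors agreeing off `Q`, a set `S₀ ⊆ Q` of edges already sent to `S` and
increasing `A`, `B`: `E[1_{A □_{S₀ ∪ S} B}] ≤ E[1_{A □_{S₀} B}]`, `S = run t ω ω'`. -/
theorem DTree.vdbk_aux (t : DTree E) : ∀ (Q S₀ : Set E) (p₁ p₂ : E → ℝ), Proper t Q →
    IsProb p₁ → IsProb p₂ → (∀ e, e ∉ Q → p₁ e = p₂ e) → S₀ ⊆ Q →
    ∀ {A B : Set (Config E)}, IsUpperSet A → IsUpperSet B →
      expectPair p₁ p₂ (fun ω ω' => disjInd A B (S₀ ∪ run t ω ω') ω ω') ≤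
        expectPair p₁ p₂ (fun ω ω' => disjInd A B S₀ ω ω') := by
  induction t with
  | leaf =>
    intro Q S₀ p₁ p₂ _ _ _ _ _ A B _ _
    simp only [DTree.run, Set.union_empty]
    exact le_rfl
  | node e toS next ih =>
    intro Q S₀ p₁ p₂ ht hp₁ hp₂ hoff hS₀ A B hA hB
    obtain ⟨heQ, hnext⟩ := ht
    have heS₀ : e ∉ S₀ := fun h => heQ (hS₀ h)
    have hce : p₁ e = p₂ e := hoff e heQ
    set S₀' : Set E := S₀ ∪ (if toS then {e} else ∅) with hS₀'
    have hS₀'Q : S₀' ⊆ insert e Q := by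
      rw [hS₀']
      refine Set.union_subset (hS₀.trans (Set.subset_insert e Q)) ?_
      split_ifs
      · exact Set.singleton_subset_iff.mpr (Set.mem_insert e Q)
      · exact Set.empty_subset _
    -- the bound in each cell `(b, b')`
    have hcell : ∀ b b' : Bool,
        expectPair (upd p₁ e b) (upd p₂ e b')
            (fun ω ω' => disjInd A B (S₀ ∪ DTree.run (DTree.node e toS next) ω ω') ω ω') ≤
          expectPair (upd p₁ e b) (upd p₂ e b') (fun ω ω' => disjInd A B S₀' ω ω') := by
      intro b b'
      have hoff' : ∀ e', e' ∉ insert e Q → upd p₁ e b e' = upd p₂ e b' e' := by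
        intro e' he'
        have hne : e' ≠ e := fun h => he' (h ▸ Set.mem_insert e Q)
        have he'Q : e' ∉ Q := fun h => he' (Set.mem_insert_of_mem _ h)
        simp only [upd, Function.update_of_ne hne]
        exact hoff e' he'Q
      have hih := ih b b' (insert e Q) S₀' (upd p₁ e b) (upd p₂ e b') (hnext b b')
        (isProb_upd hp₁ e b) (isProb_upd hp₂ e b') hoff' hS₀'Q hA hB
      refine le_trans (le_of_eq ?_) hih
      refine expectPair_congr fun ω ω' h1 h2 => ?_
      have hω : ω e = b := eq_of_weight_upd_ne_zero h1
      have hω' : ω' e = b' := eq_of_weight_upd_ne_zero h2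
      simp only [DTree.run, hω, hω', hS₀', Set.union_assoc]
    calc expectPair p₁ p₂
          (fun ω ω' => disjInd A B (S₀ ∪ DTree.run (DTree.node e toS next) ω ω') ω ω')
        = ∑ b : Bool, ∑ b' : Bool, cf p₁ e b * cf p₂ e b' *
            expectPair (upd p₁ e b) (upd p₂ e b')
              (fun ω ω' => disjInd A B (S₀ ∪ DTree.run (DTree.node e toS next) ω ω') ω ω') :=
          expectPair_split p₁ p₂ e _
      _ ≤ ∑ b : Bool, ∑ b' : Bool, cf p₁ e b * cf p₂ e b' *
            expectPair (upd p₁ e b) (upd p₂ e b') (fun ω ω' => disjInd A B S₀' ω ω') := by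
          refine Finset.sum_le_sum fun b _ => Finset.sum_le_sum fun b' _ => ?_
          exact mul_le_mul_of_nonneg_left (hcell b b')
            (mul_nonneg (cf_nonneg hp₁ e b) (cf_nonneg hp₂ e b'))
      _ = expectPair p₁ p₂ (fun ω ω' => disjInd A B S₀' ω ω') :=
          (expectPair_split p₁ p₂ e _).symm
      _ ≤ expectPair p₁ p₂ (fun ω ω' => disjInd A B S₀ ω ω') := by
          cases toS with
          | true =>
            simp only [hS₀', if_true, Set.union_singleton]
            exact expectPair_disjInd_insert_le hp₁ hp₂ hA hB heS₀ hce
          | false =>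
            simp only [hS₀', Bool.false_eq_true, if_false, Set.union_empty]
            exact le_rfl

/-- **Gladkov's Theorem 4.3 (the van den Berg–Kesten inequality for decision trees)**: for a
proper decision tree `t` building `S = run t ω ω'` from two independent configurations of law
`p`, and increasing events `A`, `B`, `P((ω, ω') ∈ A □_S B) ≤ P(A) · P(B)`. -/
theorem DTree.vdbk {p : E → ℝ} (hp : IsProb p) {t : DTree E} (ht : Proper t ∅)
    {A B : Set (Config E)} (hA : IsUpperSet A) (hB : IsUpperSet B) :
    ∑ ω, ∑ ω', weight p ω * weight p ω' * disjInd A B (run t ω ω') ω ω' ≤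
      prob p A * prob p B := by
  have h := DTree.vdbk_aux t ∅ ∅ p p ht hp hp (fun _ _ => rfl) (Set.Subset.refl _) hA hB
  simp only [Set.empty_union] at h
  refine h.trans (le_of_eq ?_)
  unfold expectPair prob
  rw [Finset.sum_mul_sum]
  refine Finset.sum_congr rfl fun ω _ => Finset.sum_congr rfl fun ω' _ => ?_
  simp only [disjInd]
  by_cases ha : ω ∈ A <;> by_cases hb : ω' ∈ B
  · rw [if_pos (disjOcc_empty_iff.mpr ⟨ha, hb⟩), Set.indicator_of_mem ha, Set.indicator_of_mem hb]
    ring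
  · rw [if_neg fun h => hb (disjOcc_empty_iff.mp h).2, Set.indicator_of_notMem hb]; ring
  · rw [if_neg fun h => ha (disjOcc_empty_iff.mp h).1, Set.indicator_of_notMem ha]; ring
  · rw [if_neg fun h => ha (disjOcc_empty_iff.mp h).1, Set.indicator_of_notMem ha]; ring

end Sums

end PercRepro
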